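import Literature.MathematicalPhysics.QuantumManyBody.BoseGasHardLayerLines
import Literature.MathematicalPhysics.QuantumManyBody.PeriodicFormDomain
import HarnessLib

/-!
# Cutting a core function off near the hard configurations: pointwise bookkeeping

Topic `Literature/MathematicalPhysics/QuantumManyBody`, sequel of `BoseGasHardLayerLines.lean` and `PeriodicFormDomain.lean`. For the
form-core theorem with hard-core pair potentials one multiplies a core function `Ψ` (`C¹`, torus periodic,
Bose symmetric) by a real cut-off `ξ ∈ [0, 1]` vanishing on `hardLayer v L θ` and computes the energy of `Φ = ξΨ`:

* `ofReal_mul_mem_periodicCore` — `Φ` is a core function;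
* `kineticDensity_cutoff_mul_le` — `|∇Φ|² ≤ (1+θ')|∇Ψ|² + (1+1/θ') 3N D² 1_A |Ψ|²` when `‖∇ξ‖ ≤ D` and `∇ξ = 0` off `A`;
* `pot_ofReal_mul_le` — `W_v |Φ|² ≤ W_{awayProfile v θ} |Ψ|²` (off `hardLayer v L θ` every image pair is at distance `≥ θ`
  from the hard radii, where the softened profile IS the profile: `periodicInteraction_eq_awayProfile_of_notMem`);
* `nnnorm_sq_le_add_indicator` — `|Ψ|² ≤ |Φ|² + 1_A |Ψ|²` when `ξ = 1` off `A`;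
* `lintegral_awayProfile_norm_ne_top` — the softened profile of a finite-range potential is integrable on `ℝ³`
  (it lives on a loose shell, `setLIntegral_looseShell_lt_top`); `lintegral_norm_ne_top_of_hardRad_eq_empty` — so is a
  finite-range potential without hard radii.

Tagged folklore.
-/

noncomputable section

open MeasureTheory Set Metric Filter Topology
open scoped ENNReal

namespace Literature.MathematicalPhysics.QuantumManyBody.BoseGas

variable {N : ℕ} {L : ℝ} {v : ℝ → ℝ≥0∞}

namespace HardLayerAux

/-- Young's inequality `|a + b|² ≤ (1 + 1/θ)|a|² + (1 + θ)|b|²`. [folklore] -/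
theorem norm_add_sq_le_young {E : Type*} [SeminormedAddCommGroup E] (a b : E) {θ : ℝ} (hθ : 0 < θ) :
    ‖a + b‖ ^ 2 ≤ (1 + θ⁻¹) * ‖a‖ ^ 2 + (1 + θ) * ‖b‖ ^ 2 := by
  have h1 : ‖a + b‖ ^ 2 ≤ (‖a‖ + ‖b‖) ^ 2 := pow_le_pow_left₀ (norm_nonneg _) (norm_add_le a b) 2
  have h2 : θ * ((1 + θ⁻¹) * ‖a‖ ^ 2 + (1 + θ) * ‖b‖ ^ 2 - (‖a‖ + ‖b‖) ^ 2) = (‖a‖ - θ * ‖b‖) ^ 2 := by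
    field_simp
    ring
  have h3 : 0 ≤ (1 + θ⁻¹) * ‖a‖ ^ 2 + (1 + θ) * ‖b‖ ^ 2 - (‖a‖ + ‖b‖) ^ 2 := by
    have h4 : 0 ≤ θ * ((1 + θ⁻¹) * ‖a‖ ^ 2 + (1 + θ) * ‖b‖ ^ 2 - (‖a‖ + ‖b‖) ^ 2) := by
      rw [h2]; exact sq_nonneg _
    exact le_of_mul_le_mul_left (by rw [mul_zero]; exact h4) hθ
  linarith

/-- The product rule for a real cut-off times a complex function, evaluated. [folklore] -/
theorem fderiv_ofReal_mul_apply {ξ : Config N → ℝ} {Ψ : Config N → ℂ} (hξ : Differentiable ℝ ξ)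
    (hΨ : Differentiable ℝ Ψ) (X H : Config N) :
    fderiv ℝ (fun X => (ξ X : ℂ) * Ψ X) X H = (fderiv ℝ ξ X H : ℂ) * Ψ X + (ξ X : ℂ) * fderiv ℝ Ψ X H := by
  have h1 : HasFDerivAt (fun X => (ξ X : ℂ)) (Complex.ofRealCLM.comp (fderiv ℝ ξ X)) X :=
    Complex.ofRealCLM.hasFDerivAt.comp X (hξ X).hasFDerivAt
  have h2 : HasFDerivAt (fun X => (ξ X : ℂ) * Ψ X) _ X := h1.mul (hΨ X).hasFDerivAt
  rw [h2.fderiv]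
  simp [Complex.ofRealCLM_apply]
  ring

end HardLayerAux

open HardLayerAux

/-! ### The product is a core function -/

/-- A `C¹`, torus-periodic, permutation-symmetric real cut-off times a core function is a core function. [folklore] -/
theorem ofReal_mul_mem_periodicCore {ξ : Config N → ℝ} (hξ : ContDiff ℝ 1 ξ) (hper : IsTorusPeriodic L ξ)
    (hsym : ∀ (σ : Equiv.Perm (Fin N)) (X : Config N), ξ (X ∘ σ) = ξ X) {Ψ : Config N → ℂ}
    (hΨ : Ψ ∈ periodicCore N L) : (fun X => (ξ X : ℂ) * Ψ X) ∈ periodicCore N L := by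
  refine ⟨(Complex.ofRealCLM.contDiff.comp hξ).mul hΨ.1, fun X i k => ?_, fun σ X => ?_⟩
  · simp only [hper X i k, hΨ.2.1 X i k]
  · simp only [hsym σ X, hΨ.2.2 σ X]

/-! ### Kinetic energy of the product -/

/-- **Kinetic density of the cut-off product.** If `0 ≤ ξ ≤ 1`, `‖∇ξ‖ ≤ D` and `∇ξ = 0` off `A`, then for every
`θ > 0`, `|∇(ξΨ)|²(X) ≤ (1+θ) |∇Ψ|²(X) + (1 + 1/θ) · 3N · D² · 1_A(X) |Ψ(X)|²`. [folklore] -/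
theorem kineticDensity_cutoff_mul_le {ξ : Config N → ℝ} {Ψ : Config N → ℂ} (hξ : Differentiable ℝ ξ)
    (hΨ : Differentiable ℝ Ψ) (h01 : ∀ X, 0 ≤ ξ X ∧ ξ X ≤ 1) {D : ℝ} (hD : ∀ X, ‖fderiv ℝ ξ X‖ ≤ D)
    {A : Set (Config N)} (hA : ∀ X ∉ A, fderiv ℝ ξ X = 0) {θ : ℝ} (hθ : 0 < θ) (X : Config N) :
    kineticDensity (fun X => (ξ X : ℂ) * Ψ X) X ≤ ENNReal.ofReal (1 + θ) * kineticDensity Ψ X +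
      ENNReal.ofReal ((1 + θ⁻¹) * (3 * N) * D ^ 2) * A.indicator (1 : Config N → ℝ≥0∞) X * (‖Ψ X‖₊ : ℝ≥0∞) ^ 2 := by
  have hD0 : 0 ≤ D := (norm_nonneg _).trans (hD X)
  have hsingle : ∀ (i : Fin N) (k : Fin 3), ‖(Pi.single i (EuclideanSpace.single k (1 : ℝ)) : Config N)‖ = 1 :=
    fun i k => by rw [Pi.norm_single, EuclideanSpace.single, PiLp.norm_single, norm_one]
  -- the two summands of the product rule
  have hb : ∀ (i : Fin N) (k : Fin 3),
      ‖(ξ X : ℂ) * fderiv ℝ Ψ X (Pi.single i (EuclideanSpace.single k (1 : ℝ)))‖ ≤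
        ‖fderiv ℝ Ψ X (Pi.single i (EuclideanSpace.single k (1 : ℝ)))‖ := fun i k => by
    rw [norm_mul, Complex.norm_real, Real.norm_eq_abs, abs_of_nonneg (h01 X).1]
    exact mul_le_of_le_one_left (norm_nonneg _) (h01 X).2
  have ha : ∀ (i : Fin N) (k : Fin 3),
      ‖((fderiv ℝ ξ X (Pi.single i (EuclideanSpace.single k (1 : ℝ))) : ℝ) : ℂ) * Ψ X‖ ≤ D * ‖Ψ X‖ := fun i k => by
    rw [norm_mul, Complex.norm_real, Real.norm_eq_abs]
    refine mul_le_mul_of_nonneg_right ?_ (norm_nonneg _)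
    calc |fderiv ℝ ξ X (Pi.single i (EuclideanSpace.single k (1 : ℝ)))|
        ≤ ‖fderiv ℝ ξ X‖ * ‖(Pi.single i (EuclideanSpace.single k (1 : ℝ)) : Config N)‖ := by
          rw [← Real.norm_eq_abs]; exact ContinuousLinearMap.le_opNorm _ _
      _ ≤ D := by rw [hsingle, mul_one]; exact hD X
  unfold kineticDensity
  by_cases hX : X ∈ A
  · rw [indicator_of_mem hX, Pi.one_apply, mul_one, Finset.mul_sum]
    have hterm : ∀ (i : Fin N) (k : Fin 3),
        ((‖fderiv ℝ (fun X => (ξ X : ℂ) * Ψ X) X (Pi.single i (EuclideanSpace.single k (1 : ℝ)))‖₊ : ℝ≥0∞)) ^ 2 ≤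
          ENNReal.ofReal (1 + θ) * ((‖fderiv ℝ Ψ X (Pi.single i (EuclideanSpace.single k (1 : ℝ)))‖₊ : ℝ≥0∞)) ^ 2 +
            ENNReal.ofReal ((1 + θ⁻¹) * D ^ 2) * (‖Ψ X‖₊ : ℝ≥0∞) ^ 2 := by
      intro i k
      rw [coe_nnnorm_sq_eq_ofReal, coe_nnnorm_sq_eq_ofReal, coe_nnnorm_sq_eq_ofReal, fderiv_ofReal_mul_apply hξ hΨ,
        ← ENNReal.ofReal_mul (by positivity), ← ENNReal.ofReal_mul (by positivity),
        ← ENNReal.ofReal_add (by positivity) (by positivity)]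
      refine ENNReal.ofReal_le_ofReal ((norm_add_sq_le_young _ _ hθ).trans ?_)
      have h1 := pow_le_pow_left₀ (norm_nonneg _) (ha i k) 2
      have h2 := pow_le_pow_left₀ (norm_nonneg _) (hb i k) 2
      have hθ' : 0 ≤ 1 + θ⁻¹ := by positivity
      nlinarith [mul_le_mul_of_nonneg_left h1 hθ', mul_le_mul_of_nonneg_left h2 (by positivity : (0 : ℝ) ≤ 1 + θ)]
    calc ∑ i : Fin N, ∑ k : Fin 3,
          ((‖fderiv ℝ (fun X => (ξ X : ℂ) * Ψ X) X (Pi.single i (EuclideanSpace.single k (1 : ℝ)))‖₊ : ℝ≥0∞)) ^ 2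
        ≤ ∑ i : Fin N, ∑ k : Fin 3,
            (ENNReal.ofReal (1 + θ) * ((‖fderiv ℝ Ψ X (Pi.single i (EuclideanSpace.single k (1 : ℝ)))‖₊ : ℝ≥0∞)) ^ 2 +
              ENNReal.ofReal ((1 + θ⁻¹) * D ^ 2) * (‖Ψ X‖₊ : ℝ≥0∞) ^ 2) :=
          Finset.sum_le_sum fun i _ => Finset.sum_le_sum fun k _ => hterm i k
      _ = ∑ i : Fin N, ENNReal.ofReal (1 + θ) * ∑ k : Fin 3,
            ((‖fderiv ℝ Ψ X (Pi.single i (EuclideanSpace.single k (1 : ℝ)))‖₊ : ℝ≥0∞)) ^ 2 +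
            (N : ℝ≥0∞) * (3 * (ENNReal.ofReal ((1 + θ⁻¹) * D ^ 2) * (‖Ψ X‖₊ : ℝ≥0∞) ^ 2)) := by
          simp only [Finset.sum_add_distrib, Finset.mul_sum, Finset.sum_const, Finset.card_univ, Fintype.card_fin,
            nsmul_eq_mul]
          push_cast
          ring
      _ = _ := by
          rw [show ENNReal.ofReal ((1 + θ⁻¹) * (3 * N) * D ^ 2) = (N : ℝ≥0∞) * 3 * ENNReal.ofReal ((1 + θ⁻¹) * D ^ 2) by
            rw [show (1 + θ⁻¹) * (3 * N) * D ^ 2 = (N * 3 : ℝ) * ((1 + θ⁻¹) * D ^ 2) by ring,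
              ENNReal.ofReal_mul (by positivity)]
            congr 1
            rw [ENNReal.ofReal_mul (Nat.cast_nonneg _), ENNReal.ofReal_natCast, ENNReal.ofReal_ofNat]]
          ring
  · rw [indicator_of_notMem hX, mul_zero, zero_mul, add_zero, Finset.mul_sum]
    refine Finset.sum_le_sum fun i _ => ?_
    rw [Finset.mul_sum]
    refine Finset.sum_le_sum fun k _ => ?_
    have h0 : fderiv ℝ (fun X => (ξ X : ℂ) * Ψ X) X (Pi.single i (EuclideanSpace.single k (1 : ℝ))) =
        (ξ X : ℂ) * fderiv ℝ Ψ X (Pi.single i (EuclideanSpace.single k (1 : ℝ))) := by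
      rw [fderiv_ofReal_mul_apply hξ hΨ, hA X hX]; simp
    rw [h0]
    calc ((‖(ξ X : ℂ) * fderiv ℝ Ψ X (Pi.single i (EuclideanSpace.single k (1 : ℝ)))‖₊ : ℝ≥0∞)) ^ 2
        ≤ ((‖fderiv ℝ Ψ X (Pi.single i (EuclideanSpace.single k (1 : ℝ)))‖₊ : ℝ≥0∞)) ^ 2 := by
          gcongr
          rw [← NNReal.coe_le_coe, coe_nnnorm, coe_nnnorm]
          exact hb i k
      _ = 1 * _ := (one_mul _).symm
      _ ≤ _ := by
          gcongr
          rw [← ENNReal.ofReal_one]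
          exact ENNReal.ofReal_le_ofReal (by linarith)

/-! ### Potential energy and norm of the product -/

/-- Off the hard layer of width `θ` the softened profile sees the same interaction as the profile. [folklore] -/
theorem periodicInteraction_eq_awayProfile_of_notMem {θ : ℝ} {X : Config N}
    (hX : X ∉ (hardLayer v L θ : Set (Config N))) :
    periodicInteraction v L X = periodicInteraction (awayProfile v θ) L X := by
  unfold periodicInteraction periodizedPotential
  refine Finset.sum_congr rfl fun i _ => Finset.sum_congr rfl fun j hj => tsum_congr fun n => ?_
  have hij : i ≠ j := (Finset.mem_filter.1 hj).2.ne
  have h : ¬ infDist (pairRad L X i j n) (hardRad v) ≤ θ := fun h => hX ⟨i, j, n, hij, h⟩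
  rw [← pairRad, awayProfile_eq_of_le (not_le.1 h).le]

/-- The periodic interaction is monotone in the profile. [folklore] -/
theorem periodicInteraction_mono_profile {v w : ℝ → ℝ≥0∞} (h : ∀ r, w r ≤ v r) (L : ℝ) (X : Config N) :
    periodicInteraction w L X ≤ periodicInteraction v L X := by
  unfold periodicInteraction periodizedPotential
  exact Finset.sum_le_sum fun i _ => Finset.sum_le_sum fun j _ => ENNReal.tsum_le_tsum fun n => h _

/-- The cut-off product has smaller modulus. [folklore] -/
theorem nnnorm_ofReal_mul_sq_le {ξ : Config N → ℝ} (h01 : ∀ X, 0 ≤ ξ X ∧ ξ X ≤ 1) (Ψ : Config N → ℂ)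
    (X : Config N) : ((‖(ξ X : ℂ) * Ψ X‖₊ : ℝ≥0∞)) ^ 2 ≤ (‖Ψ X‖₊ : ℝ≥0∞) ^ 2 := by
  gcongr
  rw [← NNReal.coe_le_coe, coe_nnnorm, coe_nnnorm, norm_mul, Complex.norm_real, Real.norm_eq_abs,
    abs_of_nonneg (h01 X).1]
  exact mul_le_of_le_one_left (norm_nonneg _) (h01 X).2

/-- **Potential energy of the cut-off product**: if `ξ ∈ [0,1]` vanishes on `hardLayer v L θ` then
`W_v |ξΨ|² ≤ W_{awayProfile v θ} |Ψ|²` pointwise. [folklore] -/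
theorem pot_ofReal_mul_le {ξ : Config N → ℝ} (h01 : ∀ X, 0 ≤ ξ X ∧ ξ X ≤ 1) {θ : ℝ}
    (h0 : ∀ X ∈ (hardLayer v L θ : Set (Config N)), ξ X = 0) (Ψ : Config N → ℂ) (X : Config N) :
    periodicInteraction v L X * ((‖(ξ X : ℂ) * Ψ X‖₊ : ℝ≥0∞)) ^ 2 ≤
      periodicInteraction (awayProfile v θ) L X * (‖Ψ X‖₊ : ℝ≥0∞) ^ 2 := by
  by_cases hX : X ∈ (hardLayer v L θ : Set (Config N))
  · rw [h0 X hX]; simp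
  · rw [periodicInteraction_eq_awayProfile_of_notMem hX]
    exact mul_le_mul_right (nnnorm_ofReal_mul_sq_le h01 Ψ X) _

/-- **Mass of the cut-off product**: if `ξ ∈ [0,1]` equals `1` off `A` then `|Ψ|² ≤ |ξΨ|² + 1_A |Ψ|²`. [folklore] -/
theorem nnnorm_sq_le_add_indicator {ξ : Config N → ℝ} {A : Set (Config N)} (h1 : ∀ X ∉ A, ξ X = 1)
    (Ψ : Config N → ℂ) (X : Config N) :
    (‖Ψ X‖₊ : ℝ≥0∞) ^ 2 ≤ ((‖(ξ X : ℂ) * Ψ X‖₊ : ℝ≥0∞)) ^ 2 + A.indicator (1 : Config N → ℝ≥0∞) X * (‖Ψ X‖₊ : ℝ≥0∞) ^ 2 := by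
  by_cases hX : X ∈ A
  · rw [indicator_of_mem hX, Pi.one_apply, one_mul]; exact le_add_self
  · rw [h1 X hX, indicator_of_notMem hX, zero_mul, add_zero, Complex.ofReal_one, one_mul]

/-! ### Integrability of the softened profile -/

/-- **The softened profile of a finite-range potential is integrable on `ℝ³`** (`θ > 0`): it lives on the loose shell
`looseShell v R₀ θ`, a compact set avoiding the hard set. [folklore] -/
theorem lintegral_awayProfile_norm_ne_top {R₀ : ℝ} (hv0 : ∀ r, R₀ < r → v r = 0) {θ : ℝ} (hθ : 0 < θ) :
    ∫⁻ z : Space, awayProfile v θ ‖z‖ ≠ ⊤ := by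
  have hsupp : ∀ z : Space, awayProfile v θ ‖z‖ ≠ 0 → z ∈ looseShell v R₀ θ := by
    intro z hz
    refine ⟨?_, fun h hh => ?_⟩
    · by_contra hlt
      exact hz (awayProfile_eq_zero_of_range hv0 θ (not_le.1 hlt))
    · by_contra hlt
      refine hz (awayProfile_eq_zero_of_lt ?_)
      calc infDist ‖z‖ (hardRad v) ≤ dist ‖z‖ h := infDist_le_dist_of_mem hh
        _ < θ := by rw [Real.dist_eq]; exact not_le.1 hlt
  have heq : (fun z : Space => awayProfile v θ ‖z‖) = (looseShell v R₀ θ).indicator fun z => awayProfile v θ ‖z‖ := by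
    funext z
    by_cases hz : z ∈ looseShell v R₀ θ
    · rw [indicator_of_mem hz]
    · rw [indicator_of_notMem hz]
      by_contra h
      exact hz (hsupp z h)
  rw [heq, lintegral_indicator (isClosed_looseShell R₀ θ).measurableSet]
  exact ne_top_of_le_ne_top (setLIntegral_looseShell_lt_top R₀ hθ).ne
    (lintegral_mono fun z => awayProfile_le v θ _)

/-- **A finite-range potential without hard radii is integrable on `ℝ³`.** [folklore] -/
theorem lintegral_norm_ne_top_of_hardRad_eq_empty {R₀ : ℝ} (hv0 : ∀ r, R₀ < r → v r = 0)
    (hS : hardRad v = ∅) : ∫⁻ z : Space, v ‖z‖ ≠ ⊤ := by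
  have hH : hardVec v = ∅ := by
    refine eq_empty_iff_forall_notMem.2 fun z hz => ?_
    have := mem_hardVec_iff_norm_mem_hardRad.1 hz
    rw [hS] at this
    exact this
  have heq : (fun z : Space => v ‖z‖) = (closedBall (0 : Space) R₀).indicator fun z => v ‖z‖ := by
    funext z
    by_cases hz : z ∈ closedBall (0 : Space) R₀
    · rw [indicator_of_mem hz]
    · rw [indicator_of_notMem hz]
      rw [mem_closedBall, dist_zero_right, not_le] at hz
      exact hv0 _ hz
  rw [heq, lintegral_indicator measurableSet_closedBall]
  exact (setLIntegral_lt_top_of_isCompact_subset_compl_hardVec (isCompact_closedBall _ _)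
    (by rw [hH, compl_empty]; exact subset_univ _)).ne

end Literature.MathematicalPhysics.QuantumManyBody.BoseGas

end
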